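import Mathlib
import HarnessLib
import Summits.NavierStokesRegularity.NavierStokesRegularity.Theses.AngularGalerkinLadder
import Summits.NavierStokesRegularity.NavierStokesRegularity.Theorems.RungBlowupCofinal.LerayLineRungProfile
import Summits.NavierStokesRegularity.NavierStokesRegularity.Theorems.RungBlowupCofinal.PrecessingLerayLineRungProfile
import Summits.NavierStokesRegularity.NavierStokesRegularity.Theorems.RungBlowupCofinal.PrecessingLerayReduction
import Summits.NavierStokesRegularity.NavierStokesRegularity.Theorems.RungBlowupCofinal.CasimirCutRotationInvariance
import Summits.NavierStokesRegularity.NavierStokesRegularity.Theorems.RungBlowupCofinal.Negative.MeanWaveFoldRange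
import Summits.NavierStokesRegularity.NavierStokesRegularity.Theorems.RungBlowupCofinal.Negative.SectoralWaveCasimir
import Summits.NavierStokesRegularity.NavierStokesRegularity.Theorems.RungBlowupCofinal.Negative.AzimuthalLeibniz
import Summits.NavierStokesRegularity.NavierStokesRegularity.Theorems.RungBlowupCofinal.Negative.WaveCoband
import Summits.NavierStokesRegularity.NavierStokesRegularity.Theorems.RungBlowupCofinal.PureWaveExclusion
import Summits.NavierStokesRegularity.FluidComputer.AngularGalerkinLadderBasics

/-!
# Line `qlwave` for crux K1 `RungBlowupCofinal` (stmt-NavierStokesRegularity-19959) — the EXACT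
# QUASI-LINEAR SECTOR of the angular Galerkin ladder: mean flow + ONE precessing azimuthal wave

Strategist line (cstrat-19959 g1; v2 by g2, v3/v4 by g2/g3, v5/v5.1 by g4 — see the version log below), registered beside `Lines/leray.lean` (steady Leray roots through a
Newton–Kantorovich door) and `Lines/birth.lean` / `Lines/halfturn.lean` (forward DSS blow-up + tangent
flow). Card: `Lines/qlwave.md`.

## The lever (one sentence)

Fix the rotation axis `e₃` and a fold number `n` with `L < 2n`. A rung-`L` field made of a ZONAL part `V`
(`J₃V = 0`, azimuthal wavenumber `m = 0`) and ONE azimuthal WAVE `W` (`J₃²W = −n²W`, `m = ±n`,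
`J₃ = angGen 2`) has its wave–wave interaction `(W·∇)W − ⟨(W·∇)W⟩₀` entirely in the sectors
`m = ±2n`; since `|m| ≤ j` on degree-`j` vector harmonics and `2n > L`, that interaction is
`L²`-orthogonal to every band-limited test field: it is CO-BAND-LIMITED, i.e. it is swallowed EXACTLY by
the Galerkin defect. So on this sector `NS_L` in backward similarity variables (p525350) IS the closed
MEAN–WAVE system

  `−ΔV + ½V + ½(y·∇)V + (V·∇)V + ⟨(W·∇)W⟩₀ + ∇Q₀ = E₀`          (zonal, forced by the wave's mean Reynolds stress)
  `−ΔW + ½W + ½(y·∇)W + αJ₃W + (V·∇)W + (W·∇)V + ∇Q₁ = E₁`     (LINEAR in `W`, in the frame precessing at rate `α`)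

with `E₀, E₁` co-band-limited — Herring's single-mode mean-field equations / the GQL closure of
Marston–Chini–Tobias / the SELF-CONSISTENT MODEL of Mantič-Lugo–Arratia–Gallaire
(`0 = 𝓛U + N(U,U) + N(u,u*)`, `iωu = 𝓛_U u`: the mean flow is maintained by ONE neutral mode and
the mode is neutral ON that mean flow), but here a THEOREM of the truncation, not a model: «the
omission is exact if the nonlinear self-interaction of the deviation contributes only to the mean»
(Bengana–Tuckerman), and band-limitation `|m| ≤ L < 2n` forces exactly that. A uniformly precessing wave
has an `s`-independent Reynolds stress, so rotated-DSS rung profiles in the sector are RELATIVE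
EQUILIBRIA: steady solutions of the system above (no Floquet theory, no Hopf computation), and the wave
equation is a linear NEUTRAL-MODE problem for the operator `W ↦ −AW − αJ₃W − (V·∇)W − (W·∇)V`,
`A = −Δ + ½ + ½y·∇`, about the zonal flow that the wave itself maintains.

## v2 (cstrat-19959 g2, 2026-08-27) — what changed since ea02ea2ad58d8192

* stub 1 is DISCHARGED: `precessing_lift` is a real theorem — the forced ROTATING Leray reduction landed
  (p526882 `AngularGalerkinLadderPrecessingReduction.isClassicalNSSolutionOn_pvAnsatz_forced`), the slices are
  band-limited resp. co-band-limited by rotation invariance (p522722 `isBandLimited_rotZ_conj`, `isCobandLimited_rotZ_conj`) and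
  dilation invariance (p517517 `isBandLimited_smul_comp_smul`, `isCobandLimited_smul_comp_smul`) of the Casimir cut,
  and p518969 `rungIsSingular_of_precessingLeray` concludes. The composition `RungBlowupCofinal_of` now takes the TWO
  open letters (closure, cofinal mean–wave profiles); registered stubs = `stub_wave_cobandLimited` (L; v3 cut of
  the closure, see next bullet), `stub_meanwave_profiles_cofinal` (XL, the bet), `stub_meanwave_rung_four` (plan-only).
* v3 (same day): K5-76 p539712 `AngularGalerkinLadderAzimuthalLeibniz` kernel-checked the azimuthal bookkeeping of this
  file's letters (`wave_waveFluctuation`: the fluctuation IS a `2n`-fold wave; `zonal_meanStress`; `wave_convect_of_zonal_*`),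
  so the closure stub is RE-CUT to its whole remaining content, the pure representation-theoretic lemma
  `stub_wave_cobandLimited` (a smooth `m`-fold wave with `m > L` is co-band-limited at level `L`); v2's
  `stub_ql_closure` statement is the THEOREM `ql_closure_of stub_wave_cobandLimited`.
* v4 (cstrat-19959 g3, 2026-08-27): stub 2 is DISCHARGED BY NAME — refuter5 K5-80 p545299
  `AngularGalerkinLadderWaveCoband.wave_cobandLimited` (`Theorems/RungBlowupCofinal/Negative/WaveCoband.lean`)
  proves `stub_wave_cobandLimited`'s statement letter for letter (`IsAzimuthalWave` unfolded), so the
  closure is the hypothesis-free THEOREM `ql_closure` and the composition `RungBlowupCofinal_of` takes the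
  ONE open letter `stub_meanwave_profiles_cofinal` (XL, the bet); `stub_meanwave_rung_four` stays the
  plan-only first rung. Registered stubs = those two. Kinematic non-vacuity of the sector at every rung is
  kernel (circuit g11 p549195 `ToroidalLift`, p549365 `SectoralHarmonics`, p550909 `SectoralToroidalWaves`:
  `exists_zonal_and_sectoral_wave`), the radial three-lift ansatz is typed (p551696 `SolidHarmonicLifts`,
  p552517 `SolidHarmonicTransport`, p552948 `SolidHarmonicAnsatz`), and refuter5 g6 p551605/p552344
  `MeanWaveCobandLoadBearing.meanWave_withoutCoband_all_rungs` shows stub 3 with its two co-band clauses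
  deleted holds at EVERY rung `L ≥ 1`: the whole content of stub 3 is `IsCobandLimited L E₀ ∧ IsCobandLimited L E₁`,
  i.e. "the band projections of the zonal and the wave equation hold" — the radial BVP of the card, nothing else.
* FOLD RANGE is a theorem of the line (K5-74 p535904 `AngularGalerkinLadderMeanWaveFoldRange.fold_le_of_ne_zero`):
  `fold_range_of_meanWave` — every witness of stubs 3/4 has `L/2 < n ≤ L` (so NONE at `L = 0`,
  `isEmpty_meanWave_level_zero`, consistent with p484389 `rungIsSingular_zero_false`); the admissible folds are
  `L=1 ⇒ n=1`, `L=2 ⇒ n=2`, `L=3 ⇒ n∈{2,3}`, `L=4 ⇒ n∈{3,4}`, …; the SECTORAL fold `n = L` puts the wave in the exact top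
  isotype of the rung (K5-75 p538163 `AngularGalerkinLadderSectoralWave.casimir_eq_smul_of_sectoral`,
  `isCobandLimited_pred_of_sectoral`: `𝒞W = L(L+1)W`, `W ⊥ band ≤ L−1`) and `waveConj` stays in the band
  (`isBandLimited_waveConj`, from K5-75 `isBandLimited_angGen`).
* v5 (cstrat-19959 g4, 2026-08-27): no stub changes (registered stubs = the same two; composition unchanged). Added the
  real theorems `rungIsSingular_of_meanWave` / `rungBlowupCofinal_instances_of_meanWave`: a non-trivial mean–wave
  profile at ANY cell `(L, n, α)` is a singular rung and settles every K1 instance `L₀ ≤ L` — so the first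
  certification may aim at the CHEAPEST inhabited cell of the fold-range table (card §8: `(2,2)` = 8 radial functions,
  4 in the point-reflection-odd sub-cell, coefficients machine-derived in AGL-RUNG2-STRUCTURE §1), not necessarily
  `(4, 4)`. Card §9 (drift test (S3′)) and §10 (inviscid renormalisation: what large-`L` limit objects of any cofinal
  family must be) and the STRATEGY-CENSUS g4 addendum (T6–T8, S⁺4–S⁺6, D6–D7, N5–N7) record the g4 switchboard.
  v5.1 (same seat, after circuit g12's p563211 `PureWaveExclusion` / p563711 / p564064 / p564408 landed): + import of
  `Theorems.RungBlowupCofinal.PureWaveExclusion` and the real theorems `zonal_ne_zero_of_meanWave` (card (S4) is now a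
  THEOREM: a stub-3 witness has `V ≢ 0` — no pure-wave rung profile, no bifurcation from `U = 0`) and
  `meanWave_witness_shape` (the exact search domain: `V ≢ 0`, `W ≢ 0`, `n ≤ L < 2n`, `0 < n`, `0 < L`).

## Stubs (sorries live ONLY in `stub_*`)

* (v1 stub 1, now the THEOREM `precessing_lift`) (M): a non-trivial solution `U` of the co-precessing profile system with
  co-band-limited defect and Type-I tail (`IsPrecessingRungProfile`) is a singular rung — the ROTATING
  forced Leray reduction (`∂ₜ` of the Pineau–Vicol ansatz `pvAnsatz α U` produces exactly `α·angGen 2 U`)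
  + rotation/dilation invariance of the Casimir cut (tree `IsBandLimited.conj_linearIsometryEquiv`,
  `isBandLimited_rotZ_conj`, `IsBandLimited.smul_comp_smul`) + p518969 `rungIsSingular_of_precessingLeray`.
  PROVED in v2 (`precessing_lift`); its `α = 0` letter also independently from p517517 (`precessing_lift_zero`).
* (v3 stub 2, now the THEOREM `wave_coband` = p545299 by name) a smooth `m`-fold wave with `m > L` is
  co-band-limited at level `L`; with K5-76 it gives the closure THEOREM `ql_closure` — for `L < 2n`, an
  `n`-fold wave `W` has co-band-limited self-interaction fluctuation `waveFluctuation n W`.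
* `stub_meanwave_profiles_cofinal` (XL, THE BET): cofinally in `L` the mean–wave system has a solution
  with a non-zero wave.
* `stub_meanwave_rung_four` (plan-only first rung, not used by the closer): at `(L, n) = (4, 4)`,
  `α = 0`, the sector is inhabited — the cell's octahedral MODEL root OCT-P93 read about one of its
  4-fold axes has `m ∈ {0, ±4}` only, so it IS a steady mean–wave profile (same certification target as
  `Lines/leray.lean`'s `stub_leray_rung_four`, new reading).

## Composition (real proofs)

`isPrecessingRungProfile_of_meanWave` (closure + linear algebra of the two equations: `U = V + W`,
`Q = Q₀ + Q₁`, `E = E₀ + E₁ + waveFluctuation n W`), `exists_ne_zero_of_wave_ne_zero` (a non-zero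
`n`-fold wave cannot cancel a zonal field: `W = −V ⇒ J₃W = 0 ⇒ n²W = 0`), and
`RungBlowupCofinal_of : stub₃ → …Theses.AngularGalerkinLadder.RungBlowupCofinal` (v4: the lift `precessing_lift` and the
closure `ql_closure` are theorems; `RungBlowupCofinal_of_closure : closure → stub₃ → Goal` is v2/v3's two-letter form) and the
A12 skeleton theorem `RungBlowupCofinal_skeleton : …Theses.AngularGalerkinLadder.RungBlowupCofinal` (by name, hypothesis-free, sorry = stub 3).

LABEL: KERNEL skeleton (crux workfile; planners land no Theorems). WHAT THIS IS NOT: not NS; no profile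
is constructed; nothing about the MODEL roots is asserted; no item moves.
References: [cite: Herring1963, J. Atmos. Sci. 20, 325 (single-mode mean-field equations)];
[cite: MarstonChiniTobias2016, PRL 116, 214501 = arXiv:1601.06720 (GQL)];
[cite: ManticLugoArratiaGallaire2014, PRL 113, 084501, doi:10.1103/physrevlett.113.084501 (SCM)];
[cite: BenganaTuckerman2021, Phys. Rev. Fluids 6, 063901 = arXiv:2102.07255, §2.1–2.2 p. 4 and §5 p. 8 (RZIF exact iff monochromatic)];
[cite: HaragusIooss2011, Cor. 2.13 p. 46 and §4.3 (rotating waves = steady in a rotating frame)];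
[cite: PineauVicol2026, (1.7), Thm 1.7 (arXiv:2607.09619)]; [cite: BullardGellman1954].
-/

noncomputable section

set_option linter.dupNamespace false

namespace Summit.NavierStokesRegularity.NavierStokesRegularity.Cruxes.RungBlowupCofinal.Qlwave

open scoped Topology Laplacian ContDiff RealInnerProductSpace
open Filter Set MeasureTheory InnerProductSpace
open Summit.NavierStokesRegularity.FluidComputer
open Summit.NavierStokesRegularity.FluidComputer.AngularLadder
open Literature.Analysis.FluidPDE

local notation "ℝ³" => EuclideanSpace ℝ (Fin 3)

/-- The crux this line concludes (by name). -/
abbrev Goal : Prop := Summit.NavierStokesRegularity.NavierStokesRegularity.Theses.AngularGalerkinLadder.RungBlowupCofinal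

/-! ## The objects -/

/-- **Residual of the CO-PRECESSING truncated backward Leray profile system** (`ν = 1`, `a = ½`,
precession rate `α` about `e₃`, `J₃ = angGen 2`):
`precResidual α U Q E y = −ΔU(y) + ½U(y) + ½DU(y)·y + α·(J₃U)(y) + (U·∇)U(y) + ∇Q(y) − E(y)`.
For `α = 0` this is the steady Leray profile residual of `Lines/leray.lean`. -/
def precResidual (α : ℝ) (U : ℝ³ → ℝ³) (Q : ℝ³ → ℝ) (E : ℝ³ → ℝ³) (y : ℝ³) : ℝ³ :=
  -(Δ U) y + (1 / 2 : ℝ) • U y + (1 / 2 : ℝ) • fderiv ℝ U y y + α • angGen 2 U y + convect U U y +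
    gradient Q y - E y

/-- **PRECESSING RUNG PROFILE at level `L`** with precession rate `α` and Type-I constant `C`: a
band-limited (degree `≤ L`) divergence-free profile `U`, a smooth pressure `Q`, a CONTINUOUS
co-band-limited defect `E` (continuity keeps the duality pairing of `IsCobandLimited` honest: no Bochner
junk), solving the co-precessing profile system exactly, with the tail `‖U(y)‖ ≤ C/(‖y‖+1)`. In
physical variables this is the Pineau–Vicol rotating-wave ansatz `u = pvAnsatz α U`, a
`(c, rotZ(−2α log c))`-rotated-DSS ancient field for every `c > 1`. [cite: PineauVicol2026, (1.7)] -/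
def IsPrecessingRungProfile (L : ℕ) (α C : ℝ) (U : ℝ³ → ℝ³) (Q : ℝ³ → ℝ) (E : ℝ³ → ℝ³) : Prop :=
  IsBandLimited L U ∧ VectorCalculus.IsDivFree U ∧ ContDiff ℝ ∞ Q ∧ Continuous E ∧
    IsCobandLimited L E ∧ (∀ y, precResidual α U Q E y = 0) ∧ ∀ y, ‖U y‖ ≤ C / (‖y‖ + 1)

/-- **Zonal field** (`m = 0` about `e₃`): `J₃V = 0` pointwise — for a `C¹` field the infinitesimal form
of axisymmetry WITH swirl (`V(R_θ x) = R_θ V(x)`). -/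
def IsZonal (V : ℝ³ → ℝ³) : Prop :=
  ∀ y, angGen 2 V y = 0

/-- **`n`-fold azimuthal wave** (`m = ±n` about `e₃`): `J₃(J₃W) = −n²W` pointwise — the real form of
"`W` lies in the `e^{±inφ}` isotypic component of the rotation action `(R·W)(y) = R W(R⁻¹y)`";
equivalently `R_φ·W = cos(nφ) W + sin(nφ) W'` with the quadrature companion `W' = n⁻¹J₃W`. -/
def IsAzimuthalWave (n : ℕ) (W : ℝ³ → ℝ³) : Prop :=
  ∀ y, angGen 2 (angGen 2 W) y = -(((n : ℝ) ^ 2) • W y)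

/-- The quadrature companion `W' = n⁻¹ J₃ W` of an `n`-fold wave (`R_{π/2n}·W`). -/
def waveConj (n : ℕ) (W : ℝ³ → ℝ³) : ℝ³ → ℝ³ := fun y => ((n : ℝ)⁻¹) • angGen 2 W y

/-- **Mean Reynolds stress of the wave**: the azimuthal average of its self-advection,
`⟨(W·∇)W⟩₀ = ½((W·∇)W + (W'·∇)W')` (average of `(R_φW·∇)R_φW` over `φ`, using
`R_φ·W = cos(nφ)W + sin(nφ)W'`). It has `m = 0`: it forces the zonal flow and nothing else. -/
def meanStress (n : ℕ) (W : ℝ³ → ℝ³) (y : ℝ³) : ℝ³ :=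
  (1 / 2 : ℝ) • (convect W W y + convect (waveConj n W) (waveConj n W) y)

/-- **The wave–wave fluctuation** `(W·∇)W − ⟨(W·∇)W⟩₀ = ½((W·∇)W − (W'·∇)W')`: the `m = ±2n` part of
the self-advection — the term the quasi-linear closure discards and the truncation discards FOR US when
`2n > L` (`ql_closure`, v4: K5-80 p545299 + K5-76 p539712). -/
def waveFluctuation (n : ℕ) (W : ℝ³ → ℝ³) (y : ℝ³) : ℝ³ :=
  convect W W y - meanStress n W y

/-- **MEAN–WAVE (exact quasi-linear) RUNG PROFILE** at level `L`, fold `n` with `L < 2n`, precession rate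
`α`, Type-I constant `C`: a zonal band-limited divergence-free `V` and an `n`-fold band-limited
divergence-free wave `W`, smooth pressures `Q₀, Q₁`, continuous co-band-limited defects `E₀, E₁`, with
* the ZONAL equation, forced only by the wave's mean Reynolds stress:
  `−ΔV + ½V + ½DV·y + (V·∇)V + ⟨(W·∇)W⟩₀ + ∇Q₀ = E₀`;
* the WAVE equation, LINEAR in `W`, in the frame precessing at rate `α`:
  `−ΔW + ½W + ½DW·y + αJ₃W + (V·∇)W + (W·∇)V + ∇Q₁ = E₁`;
* the joint Type-I tail `‖V(y) + W(y)‖ ≤ C/(‖y‖+1)`.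
(`α = 0`: a steady `D_{nh}`-type Leray rung root; `α ≠ 0`: a rotating wave.) -/
def IsMeanWaveProfile (L n : ℕ) (α C : ℝ) (V W : ℝ³ → ℝ³) (Q₀ Q₁ : ℝ³ → ℝ) (E₀ E₁ : ℝ³ → ℝ³) : Prop :=
  L < 2 * n ∧ IsBandLimited L V ∧ IsBandLimited L W ∧ VectorCalculus.IsDivFree V ∧
    VectorCalculus.IsDivFree W ∧ IsZonal V ∧ IsAzimuthalWave n W ∧ ContDiff ℝ ∞ Q₀ ∧ ContDiff ℝ ∞ Q₁ ∧
    Continuous E₀ ∧ Continuous E₁ ∧ IsCobandLimited L E₀ ∧ IsCobandLimited L E₁ ∧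
    (∀ y, -(Δ V) y + (1 / 2 : ℝ) • V y + (1 / 2 : ℝ) • fderiv ℝ V y y + convect V V y + meanStress n W y +
      gradient Q₀ y = E₀ y) ∧
    (∀ y, -(Δ W) y + (1 / 2 : ℝ) • W y + (1 / 2 : ℝ) • fderiv ℝ W y y + α • angGen 2 W y + convect V W y +
      convect W V y + gradient Q₁ y = E₁ y) ∧
    ∀ y, ‖V y + W y‖ ≤ C / (‖y‖ + 1)

/-! ## Stubs (sorries live ONLY here) -/

/-- (v1 stub 1 — now a THEOREM) **the precessing lift.** A precessing rung profile with `U ≢ 0` gives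
`RungIsSingular L`: put `u = pvAnsatz α (fun y _ => U y)`, `p(t,x) = (−t)⁻¹ Q(R(−αs)x/√−t)`,
`d(t,x) = (−t)^{−3/2} R(αs) E(R(−αs)x/√−t)`; the forced ROTATING Leray reduction (p526882
`isClassicalNSSolutionOn_pvAnsatz_forced`: the time derivative of the rotating ansatz is
`λ³R[½U + ½DU·y + α·angGen 2 U]`) makes `(u,p,d)` a classical forced solution on `(−∞,0)`; velocity
slices are band-limited and force slices co-band-limited by rotation + dilation invariance of the Casimir
cut (p522722 `isBandLimited_rotZ_conj` / `isCobandLimited_rotZ_conj`, p517517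
`isBandLimited_smul_comp_smul` / `isCobandLimited_smul_comp_smul`); then p518969
`rungIsSingular_of_precessingLeray` (factor `2`, screw `rotZ(−2α log 2)`). -/
theorem precessing_lift :
    ∀ (L : ℕ) (α C : ℝ) (U : ℝ³ → ℝ³) (Q : ℝ³ → ℝ) (E : ℝ³ → ℝ³),
      IsPrecessingRungProfile L α C U Q E → (∃ y, U y ≠ 0) → RungIsSingular L := by
  intro L α C U Q E h hne
  obtain ⟨hband, hdiv, hQ, -, hcob, hres, hdec⟩ := h
  have heq : ∀ z, -((1 : ℝ) • (Δ U) z) + (1 / 2 : ℝ) • U z + (1 / 2 : ℝ) • fderiv ℝ U z z +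
      α • angGen 2 U z + convect U U z + gradient Q z = E z := by
    intro z
    have h0 := hres z
    simp only [precResidual] at h0
    rw [one_smul]
    exact sub_eq_zero.mp h0
  have hcl := AngularGalerkinLadderPrecessingReduction.isClassicalNSSolutionOn_pvAnsatz_forced
    (ν := (1 : ℝ)) (α := α) hband.1 hQ heq hdiv
  refine AngularGalerkinLadderPrecessingLerayLine.rungIsSingular_of_precessingLeray hcl
    (fun t _ => ?_) (fun t ht => ?_) hdec hne
  · -- velocity slice = dilation ∘ rotation-conjugate of the band-limited profile
    exact AngularGalerkinLadderLerayLine.isBandLimited_smul_comp_smul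
      (AngularGalerkinLadderCasimirRotation.isBandLimited_rotZ_conj (α * -Real.log (-t)) hband)
      ((Real.sqrt (-t))⁻¹) ((Real.sqrt (-t))⁻¹)
  · -- force slice = dilation ∘ rotation-conjugate of the co-band-limited defect
    have hst : (Real.sqrt (-t))⁻¹ ≠ 0 :=
      inv_ne_zero (Real.sqrt_pos.2 (neg_pos.2 (Set.mem_Iio.1 ht))).ne'
    exact AngularGalerkinLadderLerayLine.isCobandLimited_smul_comp_smul
      (AngularGalerkinLadderCasimirRotation.isCobandLimited_rotZ_conj (α * -Real.log (-t)) hcob)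
      ((Real.sqrt (-t))⁻¹ ^ 3) ((Real.sqrt (-t))⁻¹) hst

/-- (v3 stub 2 — now a THEOREM, v4) **a smooth `m`-fold azimuthal wave with `m > L` is
co-band-limited at level `L`** — `L²`-orthogonal to every compactly supported field band-limited of
degree `≤ L`. PROVED by refuter5 K5-80 p545299
`AngularGalerkinLadderWaveCoband.wave_cobandLimited` (same statement with `IsAzimuthalWave` unfolded;
road: symmetry of the band defect / Casimir eigen-decomposition, no growth or support hypothesis on
the wave). With K5-76 (p539712 `wave_waveFluctuation`: the wave–wave fluctuation IS a `2n`-fold wave)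
it gives the closure theorem `ql_closure` below. [cite: BullardGellman1954] -/
theorem wave_coband :
    ∀ (L m : ℕ) (F : ℝ³ → ℝ³), L < m → ContDiff ℝ ∞ F → IsAzimuthalWave m F →
      IsCobandLimited L F :=
  fun L m F hLm hF hwave => AngularGalerkinLadderWaveCoband.wave_cobandLimited L m F hLm hF hwave

/-- **The exact quasi-linear closure** (v1/v2's stub 2; v3: modulo the wave co-band letter; v4: see
`ql_closure` for the hypothesis-free theorem):
for `L < 2n`, a smooth `n`-fold wave `W` has co-band-limited wave–wave fluctuation at level `L` — the
fluctuation is a smooth `2n`-fold wave (K5-76 `wave_waveFluctuation`, whose letters are this file's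
`waveConj` / `meanStress` / `waveFluctuation` by `rfl`) and `2n > L`. (Band-limitedness of `W` is not
even needed; kept in the signature for the composition.) -/
theorem ql_closure_of
    (h : ∀ (L m : ℕ) (F : ℝ³ → ℝ³), L < m → ContDiff ℝ ∞ F → IsAzimuthalWave m F →
      IsCobandLimited L F) :
    ∀ (L n : ℕ) (W : ℝ³ → ℝ³), L < 2 * n → IsBandLimited L W → IsAzimuthalWave n W →
      IsCobandLimited L (waveFluctuation n W) := by
  intro L n W hLn hW hwave
  have hn : n ≠ 0 := by rintro rfl; omega
  have hWs : ContDiff ℝ ∞ W := hW.1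
  have hWc : ContDiff ℝ ∞ (waveConj n W) := (contDiff_angGen hWs 2).const_smul _
  have hF : ContDiff ℝ ∞ (waveFluctuation n W) := by
    have h1 := AngularGalerkinLadderAzimuthalLeibniz.contDiff_convect hWs hWs
    have h2 := AngularGalerkinLadderAzimuthalLeibniz.contDiff_convect hWc hWc
    have e : waveFluctuation n W = fun y => convect W W y - (1 / 2 : ℝ) • (convect W W y +
        convect (waveConj n W) (waveConj n W) y) := rfl
    rw [e]
    exact h1.sub ((h1.add h2).const_smul _)
  refine h L (2 * n) (waveFluctuation n W) hLn hF ?_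
  intro y
  exact AngularGalerkinLadderAzimuthalLeibniz.wave_waveFluctuation hWs hn hwave rfl y

/-- **The exact quasi-linear closure, hypothesis-free** (v4): for `L < 2n`, a band-limited `n`-fold
wave has co-band-limited wave–wave fluctuation at level `L` — `ql_closure_of wave_coband`
(K5-76 p539712 + K5-80 p545299). -/
theorem ql_closure :
    ∀ (L n : ℕ) (W : ℝ³ → ℝ³), L < 2 * n → IsBandLimited L W → IsAzimuthalWave n W →
      IsCobandLimited L (waveFluctuation n W) :=
  ql_closure_of wave_coband

/-- stub 3 (XL, THE BET of the line): **non-trivial mean–wave rung profiles exist cofinally in `L`.**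
For cofinally many rungs there are a fold `n` (`L < 2n`; the natural ladder is the SECTORAL one,
`n = L`, where the wave has total degree exactly `j = L` and hence THREE radial coefficient functions
for every `L`), a precession rate `α`, and a solution of the mean–wave system whose wave is not
identically zero. Existence architecture (card §Stubs): the wave equation is a linear neutral-mode
problem for `−A − αJ₃ − M(V)`, `A = −Δ + ½ + ½y·∇` (spectrum of `−A` alone: `{−(1+k)/2}`, strictly
stable — so NOT a bifurcation from `U = 0`, the dead sub-mechanism of `Lines/leray.md`), about a zonal
swirling flow `V` maintained by the wave's own Reynolds stress; a neutral pair is reached by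
continuation in the wave amplitude (IVT on the spectral abscissa) and closed by a fixed point in the
mode shape; at `n = L → ∞` the sectoral wave concentrates on an equatorial ring of radius `∼ κL`
(MODEL shells `ρ_A ≈ 3.3·L`) and the system is a wave–mean-flow (WKB / homogenisation) limit in which
ONE limiting object + non-degeneracy gives all large `L`. Why it might fail: the zonal flow may fold
before the wave operator reaches neutrality, or truncated zonal flows of degree `≤ L` may be unable to
neutralise an `m ≥ L/2` wave at all (viscous damping `m²/ρ²` vs. available shear); and, as for every
K1 line, all steady/precessing `NS_L` profiles might be trivial for large `L` by a Liouville mechanism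
not in print (KJ-17: 0/14 printed criteria apply to `NS_L`). -/
theorem stub_meanwave_profiles_cofinal :
    ∀ L₀ : ℕ, ∃ L ≥ L₀, ∃ (n : ℕ) (α C : ℝ) (V W : ℝ³ → ℝ³) (Q₀ Q₁ : ℝ³ → ℝ) (E₀ E₁ : ℝ³ → ℝ³),
      IsMeanWaveProfile L n α C V W Q₀ Q₁ E₀ E₁ ∧ ∃ y, W y ≠ 0 := by
  sorry

/-- stub 4 (plan-only FIRST RUNG, not used by the closer; BC5-type witness for the mean–wave class):
**rung FOUR carries a steady (`α = 0`) mean–wave profile with fold `n = 4`.** Reading: an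
`O_h`-symmetric rung-4 field is `D_{4h}`-symmetric about each coordinate axis, so about `e₃` its
azimuthal content is `m ∈ 4ℤ ∩ [−4, 4] = {0, ±4}` — it IS `V + W` with `V` zonal and `W` a 4-fold wave,
and `2·4 = 8 > 4` makes the closure exact: projecting the rung-4 profile system onto `m = 0` and
`m = ±4` gives exactly the two mean–wave equations (the cross terms `V–W` have `m = ±4`, `(W·∇)W` has
`m ∈ {0, ±8}`). So the cell's MODEL root OCT-P93 (`A = 22.33`, `ρ_A = 13.69`; float64, 4 codes; NOT a
proof) is numerically a steady mean–wave profile, and the certification target of `Lines/leray.lean`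
`stub_leray_rung_four` (radii polynomials on the `O_h` cell BVP) settles this stub too. Technique:
computer-assisted NK at `L = 4`; then the sector projections of `(U, P, D)`. Outside S's known regime
(nothing is proved about singular rungs `L ≥ 1`; rung 0 regular p484389; rung-3 T-cell linear p503248). -/
theorem stub_meanwave_rung_four :
    ∃ (C : ℝ) (V W : ℝ³ → ℝ³) (Q₀ Q₁ : ℝ³ → ℝ) (E₀ E₁ : ℝ³ → ℝ³),
      IsMeanWaveProfile 4 4 0 C V W Q₀ Q₁ E₀ E₁ ∧ ∃ y, W y ≠ 0 := by
  sorry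

/-! ## Compositions (real proofs) -/

/-- The sum of two divergence-free differentiable fields is divergence free (trace is additive).
[folklore] -/
private theorem isDivFree_add {φ ψ : ℝ³ → ℝ³} (hφ : VectorCalculus.IsDivFree φ)
    (hψ : VectorCalculus.IsDivFree ψ) (hφd : Differentiable ℝ φ) (hψd : Differentiable ℝ ψ) :
    VectorCalculus.IsDivFree (φ + ψ) := by
  intro x
  have h1 := hφ x
  have h2 := hψ x
  simp only [VectorCalculus.divergence] at h1 h2
  show LinearMap.trace ℝ ℝ³ (fderiv ℝ (φ + ψ) x : ℝ³ →ₗ[ℝ] ℝ³) = 0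
  rw [fderiv_add (hφd x) (hψd x)]
  simp [h1, h2]

/-- `(u·∇)v` is continuous for smooth `u, v`. [folklore] -/
private theorem continuous_convect {u v : ℝ³ → ℝ³} (hu : ContDiff ℝ ∞ u) (hv : ContDiff ℝ ∞ v) :
    Continuous (convect u v) := by
  have e : convect u v = fun y => (fderiv ℝ v y) (u y) := rfl
  rw [e]
  exact ((hv.continuous_fderiv (by simp)).clm_apply hu.continuous)

/-- The quadrature companion of a smooth wave is smooth. [folklore] -/
theorem contDiff_waveConj {n : ℕ} {W : ℝ³ → ℝ³} (hW : ContDiff ℝ ∞ W) : ContDiff ℝ ∞ (waveConj n W) := by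
  have h : ContDiff ℝ ∞ (angGen 2 W) := contDiff_angGen hW 2
  exact h.const_smul _

/-- The wave–wave fluctuation of a smooth wave is continuous (so its defect pairing is a genuine
integral). [folklore] -/
theorem continuous_waveFluctuation {n : ℕ} {W : ℝ³ → ℝ³} (hW : ContDiff ℝ ∞ W) :
    Continuous (waveFluctuation n W) := by
  have h1 : Continuous (convect W W) := continuous_convect hW hW
  have h2 : Continuous (convect (waveConj n W) (waveConj n W)) :=
    continuous_convect (contDiff_waveConj hW) (contDiff_waveConj hW)
  have e : waveFluctuation n W = fun y => convect W W y - (1 / 2 : ℝ) • (convect W W y +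
      convect (waveConj n W) (waveConj n W) y) := rfl
  rw [e]
  fun_prop

/-- **A non-zero `n`-fold wave cannot cancel a zonal field** (`n ≠ 0`): if `V` is zonal, `W` is an
`n`-fold wave and `W ≢ 0`, then `V + W ≢ 0` — were `V + W ≡ 0`, `J₃W = −J₃V = 0`, hence
`n²W = −J₃²W = 0`. [folklore] -/
theorem exists_ne_zero_of_wave_ne_zero {n : ℕ} {V W : ℝ³ → ℝ³} (hn : n ≠ 0) (hVd : Differentiable ℝ V)
    (hV : IsZonal V) (hW : IsAzimuthalWave n W) (hne : ∃ y, W y ≠ 0) :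
    ∃ y, (V + W) y ≠ 0 := by
  by_contra hall
  push Not at hall
  have hWV : W = (-1 : ℝ) • V := by
    funext y
    have h := hall y
    rw [Pi.add_apply] at h
    rw [Pi.smul_apply, neg_one_smul]
    exact eq_neg_of_add_eq_zero_right h
  have hJW : angGen 2 W = 0 := by
    rw [hWV, angGen_smul hVd (-1 : ℝ) 2]
    funext y
    rw [Pi.smul_apply, hV y, smul_zero, Pi.zero_apply]
  obtain ⟨y, hy⟩ := hne
  have h2 := hW y
  rw [hJW, angGen_zero, Pi.zero_apply] at h2
  have hn2 : ((n : ℝ) ^ 2) ≠ 0 := by positivity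
  have : ((n : ℝ) ^ 2) • W y = 0 := by
    have h3 := congrArg Neg.neg h2
    rw [neg_zero, neg_neg] at h3
    exact h3.symm
  exact hy ((smul_eq_zero.mp this).resolve_left hn2)

/-- **The exact quasi-linear reduction** (real proof from the closure letter): a mean–wave profile
`(V, W)` assembles into a precessing rung profile `U = V + W`, `Q = Q₀ + Q₁`,
`E = E₀ + E₁ + ((W·∇)W − ⟨(W·∇)W⟩₀)` — the wave–wave fluctuation joins the defect, legitimately,
because the closure letter makes it co-band-limited. -/
theorem isPrecessingRungProfile_of_meanWave
    (hcl : ∀ (L n : ℕ) (W : ℝ³ → ℝ³), L < 2 * n → IsBandLimited L W → IsAzimuthalWave n W →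
      IsCobandLimited L (waveFluctuation n W))
    {L n : ℕ} {α C : ℝ} {V W : ℝ³ → ℝ³} {Q₀ Q₁ : ℝ³ → ℝ} {E₀ E₁ : ℝ³ → ℝ³}
    (h : IsMeanWaveProfile L n α C V W Q₀ Q₁ E₀ E₁) :
    IsPrecessingRungProfile L α C (V + W) (Q₀ + Q₁) (E₀ + E₁ + waveFluctuation n W) := by
  obtain ⟨hLn, hV, hW, hdV, hdW, hzon, hwav, hQ₀, hQ₁, hE₀c, hE₁c, hE₀, hE₁, hmean, hwave, hdec⟩ := h
  have hVs : ContDiff ℝ ∞ V := hV.1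
  have hWs : ContDiff ℝ ∞ W := hW.1
  have hVd : Differentiable ℝ V := hVs.differentiable (by simp)
  have hWd : Differentiable ℝ W := hWs.differentiable (by simp)
  have hflc : Continuous (waveFluctuation n W) := continuous_waveFluctuation hWs
  have hfl : IsCobandLimited L (waveFluctuation n W) := hcl L n W hLn hW hwav
  refine ⟨hV.add hW, isDivFree_add hdV hdW hVd hWd, hQ₀.add hQ₁, (hE₀c.add hE₁c).add hflc,
    (hE₀.add hE₁ hE₀c hE₁c).add hfl (hE₀c.add hE₁c) hflc, fun y => ?_, fun y => hdec y⟩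
  -- the residual identity at `y`
  have hΔ : (Δ (V + W)) y = (Δ V) y + (Δ W) y :=
    ContDiffAt.laplacian_add (hVs.of_le (by norm_cast)).contDiffAt (hWs.of_le (by norm_cast)).contDiffAt
  have hD : fderiv ℝ (V + W) y = fderiv ℝ V y + fderiv ℝ W y := fderiv_add (hVd y) (hWd y)
  have hJ : angGen 2 (V + W) y = angGen 2 W y := by
    rw [angGen_add hVd hWd 2, Pi.add_apply, hzon y, zero_add]
  have hQd₀ : DifferentiableAt ℝ Q₀ y := (hQ₀.differentiable (by simp)) y
  have hQd₁ : DifferentiableAt ℝ Q₁ y := (hQ₁.differentiable (by simp)) y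
  have hG : gradient (Q₀ + Q₁) y = gradient Q₀ y + gradient Q₁ y := by
    simp only [gradient, fderiv_add hQd₀ hQd₁, map_add]
  have hconv : convect (V + W) (V + W) y =
      convect V V y + convect V W y + (convect W V y + convect W W y) := by
    simp only [convect, hD, Pi.add_apply, _root_.add_apply, map_add]
  have hm := hmean y
  have hw := hwave y
  simp only [precResidual, hΔ, hD, hJ, hG, hconv, Pi.add_apply, _root_.add_apply,
    waveFluctuation]
  rw [← hm, ← hw]
  module

/-- **The crux from the closure letter and the profile letter** (real proof, v2/v3 form): take a
cofinal rung with a non-trivial mean–wave profile (stub 3), assemble it into a precessing rung profile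
by the exact quasi-linear reduction (closure letter), observe `V + W ≢ 0`, and lift (`precessing_lift`,
a theorem). -/
theorem RungBlowupCofinal_of_closure
    (h2 : ∀ (L n : ℕ) (W : ℝ³ → ℝ³), L < 2 * n → IsBandLimited L W → IsAzimuthalWave n W →
      IsCobandLimited L (waveFluctuation n W))
    (h3 : ∀ L₀ : ℕ, ∃ L ≥ L₀, ∃ (n : ℕ) (α C : ℝ) (V W : ℝ³ → ℝ³) (Q₀ Q₁ : ℝ³ → ℝ) (E₀ E₁ : ℝ³ → ℝ³),
      IsMeanWaveProfile L n α C V W Q₀ Q₁ E₀ E₁ ∧ ∃ y, W y ≠ 0) : Goal := by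
  intro L₀
  obtain ⟨L, hL, n, α, C, V, W, Q₀, Q₁, E₀, E₁, hMW, hne⟩ := h3 L₀
  have hn : n ≠ 0 := by
    rintro rfl
    have h0 : L < 2 * 0 := hMW.1
    omega
  have hVd : Differentiable ℝ V := hMW.2.1.1.differentiable (by simp)
  exact ⟨L, hL, precessing_lift L α C (V + W) (Q₀ + Q₁) (E₀ + E₁ + waveFluctuation n W)
    (isPrecessingRungProfile_of_meanWave h2 hMW)
    (exists_ne_zero_of_wave_ne_zero hn hVd hMW.2.2.2.2.2.1 hMW.2.2.2.2.2.2.1 hne)⟩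

/-- **The crux from the ONE open stub** (real proof, v4): cofinal non-trivial mean–wave profiles
(`stub_meanwave_profiles_cofinal`'s statement) give `RungBlowupCofinal` — the closure (`ql_closure`) and
the lift (`precessing_lift`) are theorems. Concludes the route declaration BY NAME. -/
theorem RungBlowupCofinal_of
    (h3 : ∀ L₀ : ℕ, ∃ L ≥ L₀, ∃ (n : ℕ) (α C : ℝ) (V W : ℝ³ → ℝ³) (Q₀ Q₁ : ℝ³ → ℝ) (E₀ E₁ : ℝ³ → ℝ³),
      IsMeanWaveProfile L n α C V W Q₀ Q₁ E₀ E₁ ∧ ∃ y, W y ≠ 0) :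
    Summit.NavierStokesRegularity.NavierStokesRegularity.Theses.AngularGalerkinLadder.RungBlowupCofinal :=
  RungBlowupCofinal_of_closure ql_closure h3

/-- The hypothesis-free skeleton line (the A12 skeleton theorem: concludes the crux BY NAME; carries the
one remaining stub's `sorry` — decoration, not closure). -/
theorem RungBlowupCofinal_skeleton :
    Summit.NavierStokesRegularity.NavierStokesRegularity.Theses.AngularGalerkinLadder.RungBlowupCofinal :=
  RungBlowupCofinal_of stub_meanwave_profiles_cofinal

/-- **Which instances of the crux the first rung settles** (real proof modulo the plan-only rung
stub alone, v4): every instance `L₀ ≤ 4` of K1. -/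
theorem rungBlowupCofinal_instances_le_four
    (h4 : ∃ (C : ℝ) (V W : ℝ³ → ℝ³) (Q₀ Q₁ : ℝ³ → ℝ) (E₀ E₁ : ℝ³ → ℝ³),
      IsMeanWaveProfile 4 4 0 C V W Q₀ Q₁ E₀ E₁ ∧ ∃ y, W y ≠ 0) :
    ∀ L₀ ≤ 4, ∃ L ≥ L₀, RungIsSingular L := by
  intro L₀ hL₀
  obtain ⟨C, V, W, Q₀, Q₁, E₀, E₁, hMW, hne⟩ := h4
  have hVd : Differentiable ℝ V := hMW.2.1.1.differentiable (by simp)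
  exact ⟨4, hL₀, precessing_lift 4 0 C (V + W) (Q₀ + Q₁) (E₀ + E₁ + waveFluctuation 4 W)
    (isPrecessingRungProfile_of_meanWave ql_closure hMW)
    (exists_ne_zero_of_wave_ne_zero (by norm_num) hVd hMW.2.2.2.2.2.1 hMW.2.2.2.2.2.2.1 hne)⟩

/-- **Any inhabited cell is a singular rung** (real proof, v5): a non-trivial mean–wave profile at ANY level `L`,
fold `n` and precession rate `α` gives `RungIsSingular L` — closure (`ql_closure`), reduction
(`isPrecessingRungProfile_of_meanWave`), non-cancellation (`exists_ne_zero_of_wave_ne_zero`; `n ≠ 0` because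
`L < 2n`) and the precessing lift (`precessing_lift`). -/
theorem rungIsSingular_of_meanWave {L n : ℕ} {α C : ℝ} {V W : ℝ³ → ℝ³} {Q₀ Q₁ : ℝ³ → ℝ} {E₀ E₁ : ℝ³ → ℝ³}
    (hMW : IsMeanWaveProfile L n α C V W Q₀ Q₁ E₀ E₁) (hne : ∃ y, W y ≠ 0) : RungIsSingular L := by
  have hVd : Differentiable ℝ V := hMW.2.1.1.differentiable (by simp)
  have hn : n ≠ 0 := by
    rintro rfl
    have h := hMW.1
    omega
  exact precessing_lift L α C (V + W) (Q₀ + Q₁) (E₀ + E₁ + waveFluctuation n W)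
    (isPrecessingRungProfile_of_meanWave ql_closure hMW)
    (exists_ne_zero_of_wave_ne_zero hn hVd hMW.2.2.2.2.2.1 hMW.2.2.2.2.2.2.1 hne)

/-- **Which instances of the crux ONE cell witness settles** (real proof, v5): a non-trivial mean–wave profile at
`(L, n, α)` settles every instance `L₀ ≤ L` of K1 — the CAP target of record may therefore be the cheapest inhabited
cell of the fold-range table (card §8), e.g. `(2, 2)` or `(3, 3)`, if the MODEL census finds one. -/
theorem rungBlowupCofinal_instances_of_meanWave {L n : ℕ} {α C : ℝ} {V W : ℝ³ → ℝ³} {Q₀ Q₁ : ℝ³ → ℝ}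
    {E₀ E₁ : ℝ³ → ℝ³} (hMW : IsMeanWaveProfile L n α C V W Q₀ Q₁ E₀ E₁) (hne : ∃ y, W y ≠ 0) :
    ∀ L₀ ≤ L, ∃ L' ≥ L₀, RungIsSingular L' := fun _ hL₀ =>
  ⟨L, hL₀, rungIsSingular_of_meanWave hMW hne⟩

/-- The `(4, 4)`, `α = 0` instance theorem of v4 is the special case (consistency check, real proof). -/
theorem rungBlowupCofinal_instances_le_four'
    (h4 : ∃ (C : ℝ) (V W : ℝ³ → ℝ³) (Q₀ Q₁ : ℝ³ → ℝ) (E₀ E₁ : ℝ³ → ℝ³),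
      IsMeanWaveProfile 4 4 0 C V W Q₀ Q₁ E₀ E₁ ∧ ∃ y, W y ≠ 0) :
    ∀ L₀ ≤ 4, ∃ L ≥ L₀, RungIsSingular L := by
  obtain ⟨C, V, W, Q₀, Q₁, E₀, E₁, hMW, hne⟩ := h4
  exact rungBlowupCofinal_instances_of_meanWave hMW hne

/-- **Both parts of a mean–wave witness are load-bearing** (v5.1; circuit g12 p563211
`AngularGalerkinLadderPureWaveExclusion.zonal_ne_zero_of_wave_ne_zero`, read on the letters of
`IsMeanWaveProfile`): a witness of stub 3 has `V ≢ 0` as well as `W ≢ 0` — a pure azimuthal wave is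
never a rung profile (linear Liouville at `U = 0`: the wave residual is curl-free by the Casimir cut
(p560462), `pvAnsatz α W` is then a Type-I ancient STOKES solution, killed by KNSS Lemma 3.1 (p562145)).
Consequences for the line: the MODEL census (LC) / drift test (S3′) of the card searches only cells with
BOTH letters on; at `(L, n) = (1, 1)` the constant horizontal pair `(V, W) = (0, c)` meets every letter
of `IsMeanWaveProfile` except the tail (p563711), so the tail is the letter that empties that corner. -/
theorem zonal_ne_zero_of_meanWave {L n : ℕ} {α C : ℝ} {V W : ℝ³ → ℝ³} {Q₀ Q₁ : ℝ³ → ℝ}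
    {E₀ E₁ : ℝ³ → ℝ³} (hMW : IsMeanWaveProfile L n α C V W Q₀ Q₁ E₀ E₁) (hne : ∃ y, W y ≠ 0) :
    ∃ y, V y ≠ 0 := by
  obtain ⟨-, -, hW, -, hdivW, -, -, -, hQ₁, -, -, -, hE₁, -, hwave, hdec⟩ := hMW
  exact AngularGalerkinLadderPureWaveExclusion.zonal_ne_zero_of_wave_ne_zero hW hdivW hQ₁ hE₁ hwave
    hdec hne

/-! ## Sanity (real proofs, no stubs) -/

/-- **The `α = 0` letter of stub 1 is a THEOREM** (p517517 `rungIsSingular_of_lerayProfile`): a steady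
(`α = 0`) precessing rung profile with `U ≢ 0` is a singular rung. So stub 1 is exactly the ROTATING
extension of a landed bridge. -/
theorem precessing_lift_zero {L : ℕ} {C : ℝ} {U : ℝ³ → ℝ³} {Q : ℝ³ → ℝ} {E : ℝ³ → ℝ³}
    (h : IsPrecessingRungProfile L 0 C U Q E) (hne : ∃ y, U y ≠ 0) : RungIsSingular L := by
  obtain ⟨hband, hdiv, hQ, -, hcob, hres, hdec⟩ := h
  refine AngularGalerkinLadderLerayLine.rungIsSingular_of_lerayProfile hband.1 hQ (fun y => ?_) hdiv hband
    hcob hdec hne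
  have h0 := hres y
  simp only [precResidual, zero_smul, add_zero] at h0
  exact sub_eq_zero.mp h0

/-- The Laplacian of the zero field vanishes. [folklore] -/
private theorem laplacian_zero_field (y : ℝ³) : (Δ (0 : ℝ³ → ℝ³)) y = 0 := by
  simp [laplacian_eq_iteratedFDeriv_stdOrthonormalBasis]

/-- The zero pair is a (trivial) mean–wave profile whenever `L < 2n`, `0 ≤ C` — so the guard
`∃ y, W y ≠ 0` in stubs 3/4 is exactly what excludes it (no junk inhabitant with content). -/
theorem isMeanWaveProfile_zero {L n : ℕ} (hLn : L < 2 * n) {C : ℝ} (hC : 0 ≤ C) (α : ℝ) :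
    IsMeanWaveProfile L n α C 0 0 0 0 0 0 := by
  have hz : IsBandLimited L (0 : ℝ³ → ℝ³) := isBandLimited_zero_field L
  have hcz : IsCobandLimited L (0 : ℝ³ → ℝ³) := isCobandLimited_zero_field L
  have hf0 : ∀ y : ℝ³, fderiv ℝ (0 : ℝ³ → ℝ³) y = 0 := fun y => by
    rw [show (0 : ℝ³ → ℝ³) = fun _ => (0 : ℝ³) from rfl]; simp
  have hg0 : ∀ y : ℝ³, gradient (0 : ℝ³ → ℝ) y = 0 := fun y => by
    rw [show (0 : ℝ³ → ℝ) = fun _ => (0 : ℝ) from rfl]; simp [gradient]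
  have hdz : VectorCalculus.IsDivFree (0 : ℝ³ → ℝ³) := fun x => by
    simp only [VectorCalculus.divergence, hf0 x, ContinuousLinearMap.toLinearMap_zero, map_zero]
  have hJ0 : angGen 2 (0 : ℝ³ → ℝ³) = 0 := angGen_zero 2
  have hc0 : ∀ (u : ℝ³ → ℝ³) (y : ℝ³), convect u (0 : ℝ³ → ℝ³) y = 0 := fun u y => by
    simp only [convect, hf0 y, _root_.zero_apply]
  have hconj : waveConj n (0 : ℝ³ → ℝ³) = 0 := by
    funext y; simp [waveConj, hJ0]
  have hms : ∀ y : ℝ³, meanStress n (0 : ℝ³ → ℝ³) y = 0 := fun y => by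
    simp only [meanStress, hconj, hc0, add_zero, smul_zero]
  refine ⟨hLn, hz, hz, hdz, hdz, fun y => ?_, fun y => ?_, contDiff_const, contDiff_const,
    continuous_const, continuous_const, hcz, hcz, fun y => ?_, fun y => ?_, fun y => ?_⟩
  · simp [hJ0]
  · simp [hJ0]
  · simp [laplacian_zero_field, hf0, hms, hg0, convect]
  · simp [laplacian_zero_field, hf0, hg0, hJ0]
  · simp only [Pi.zero_apply, add_zero, norm_zero]
    positivity

/-- A zonal field is never a non-zero `n`-fold wave (`n ≠ 0`): the two sectors meet only in `0` —
so stub 3's witnesses are never the chain-dead axisymmetric objects (p466949, p497872). -/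
theorem wave_eq_zero_of_isZonal {n : ℕ} {W : ℝ³ → ℝ³} (hn : n ≠ 0) (hz : IsZonal W)
    (hw : IsAzimuthalWave n W) : ∀ y, W y = 0 := by
  intro y
  have hJ : angGen 2 W = 0 := funext fun y => by rw [hz y, Pi.zero_apply]
  have h2 := hw y
  rw [hJ, angGen_zero, Pi.zero_apply] at h2
  have hn2 : ((n : ℝ) ^ 2) ≠ 0 := by positivity
  have : ((n : ℝ) ^ 2) • W y = 0 := by
    have h3 := congrArg Neg.neg h2
    rw [neg_zero, neg_neg] at h3
    exact h3.symm
  exact (smul_eq_zero.mp this).resolve_left hn2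

/-- **FOLD RANGE of every witness** (K5-74 p535904): a mean–wave profile with `W ≢ 0` has
`L/2 < n ≤ L` — `L < 2n` is a conjunct, and a non-zero band-limited `n`-fold wave needs `n ≤ L`
(angular Bernstein `n²∫‖w‖² ≤ ∫⟪𝒞w,w⟫ ≤ L(L+1)∫‖w‖²` on radial cut-offs,
`AngularGalerkinLadderMeanWaveFoldRange.fold_le_of_ne_zero`). So the natural ladder of stub 3 is
indexed by `n ∈ (L/2, L]`, the sectoral fold `n = L` being the extreme one. [cite: BullardGellman1954] -/
theorem fold_range_of_meanWave {L n : ℕ} {α C : ℝ} {V W : ℝ³ → ℝ³} {Q₀ Q₁ : ℝ³ → ℝ} {E₀ E₁ : ℝ³ → ℝ³}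
    (h : IsMeanWaveProfile L n α C V W Q₀ Q₁ E₀ E₁) (hne : ∃ y, W y ≠ 0) : L < 2 * n ∧ n ≤ L :=
  ⟨h.1, AngularGalerkinLadderMeanWaveFoldRange.fold_le_of_ne_zero h.2.2.1 h.2.2.2.2.2.2.1 hne⟩

/-- **No mean–wave witness at rung 0** (consistent with p484389 `rungIsSingular_zero_false`): at
`L = 0` the fold range `(0, 0]` is empty. The line's witnesses start at `L = 1` at the earliest. -/
theorem isEmpty_meanWave_level_zero {n : ℕ} {α C : ℝ} {V W : ℝ³ → ℝ³} {Q₀ Q₁ : ℝ³ → ℝ} {E₀ E₁ : ℝ³ → ℝ³}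
    (h : IsMeanWaveProfile 0 n α C V W Q₀ Q₁ E₀ E₁) : ∀ y, W y = 0 := by
  by_contra hne
  push Not at hne
  have h2 := fold_range_of_meanWave h hne
  omega

/-- The quadrature companion `W' = n⁻¹J₃W` of a band-limited wave is band-limited (K5-75 p538163
`AngularGalerkinLadderSectoralWave.isBandLimited_angGen`: `[J_a, 𝒞] = 0`), so `meanStress` and
`waveFluctuation` are built from TWO band-limited waves — the form stub 2's Fourier argument uses. -/
theorem isBandLimited_waveConj {L n : ℕ} {W : ℝ³ → ℝ³} (hW : IsBandLimited L W) :
    IsBandLimited L (waveConj n W) := by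
  have h := AngularGalerkinLadderSectoralWave.isBandLimited_angGen hW 2
  have e : waveConj n W = fun y => ((n : ℝ)⁻¹) • (angGen 2 W) ((1 : ℝ) • y) := by
    funext y; simp [waveConj]
  rw [e]
  exact AngularGalerkinLadderLerayLine.isBandLimited_smul_comp_smul h _ _

/-- **A stub-3 witness is a genuinely two-letter object at a positive rung with a fold in
`(L/2, L]`** (v5.1): zonal mean non-zero (`zonal_ne_zero_of_meanWave`, p563211), wave non-zero
(hypothesis), `n ≤ L < 2n` (`fold_range_of_meanWave`, p532162), hence `0 < n` and `0 < L`
(`isEmpty_meanWave_level_zero`, consistent with p484389). This is the exact search domain of the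
card's MODEL census (LC). -/
theorem meanWave_witness_shape {L n : ℕ} {α C : ℝ} {V W : ℝ³ → ℝ³} {Q₀ Q₁ : ℝ³ → ℝ}
    {E₀ E₁ : ℝ³ → ℝ³} (hMW : IsMeanWaveProfile L n α C V W Q₀ Q₁ E₀ E₁) (hne : ∃ y, W y ≠ 0) :
    (∃ y, V y ≠ 0) ∧ (∃ y, W y ≠ 0) ∧ n ≤ L ∧ L < 2 * n ∧ 0 < n ∧ 0 < L := by
  obtain ⟨h1, h2⟩ := fold_range_of_meanWave hMW hne
  exact ⟨zonal_ne_zero_of_meanWave hMW hne, hne, h2, h1, by omega, by omega⟩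

end Summit.NavierStokesRegularity.NavierStokesRegularity.Cruxes.RungBlowupCofinal.Qlwave

end
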